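import Summits.CriticalPhenomena.CardyFormulaZ2.Theorems.CardyMeckeFlipMeckeRigidityDilationPivotal

/-!
# (F) transports under dilations: the rescaled kernel is flip-fair for the dilated law

Route `Summits/CriticalPhenomena/CardyFormulaZ2/Theses/CardyMeckeFlip`, crux `MeckeRigidity`
(item stmt-CriticalPhenomena-14826), line `registered`, similarity-covariance package (lead c3),
registered sub-goal `isFlipFairKernel_map_dilate`.

For `t > 0` let `S_t` be the dilation of configurations (`QuadConfig.dilate t`) and `m_t w = t w`.  If the
cutoff kernel `M (ε/t)` is flip-fair for `P` (clause (F) at cutoff `ε/t`), then the RESCALED kernel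
`S ↦ (m_t)_* M (ε/t) (S_{t⁻¹} S)` is flip-fair for the dilated law `(S_t)_* P` (clause (F) at cutoff `ε`).
Proof: change variables `S = S_t S'` on `ℋ_ℂ` and `x = t y` on `ℂ` (both measurable equivalences, so no
measurability of the integrands is needed), note that the crossing pattern of `Q` in `S_t S'` is the pattern of
`S_{t⁻¹} Q` in `S'` and that pivotality is dilation covariant (`isPivotalAt_dilate_iff`), and apply (F) for `P`
to the family `S_{t⁻¹} Q` and the test function `φ ∘ m_t`.
-/

noncomputable section

open MeasureTheory Set Metric Filter Topology
open scoped ENNReal NNReal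
open Literature.Probability.Percolation Literature.Probability.Percolation.QuadCrossing

namespace Summit.CriticalPhenomena.CardyFormulaZ2.Theorems.CardyMeckeFlip

/-! ### Measurable-equivalence bookkeeping for the two changes of variables -/

/-- `S ↦ S_t S` is a measurable embedding of `ℋ_ℂ` (indeed a homeomorphism with inverse `S_{t⁻¹}`).
[folklore] -/
theorem measurableEmbedding_quadConfig_dilate (t : ℝ) (ht : t ≠ 0) :
    MeasurableEmbedding (QuadConfig.dilate t ht : QuadConfig (univ : Set ℂ) → QuadConfig univ) :=
  ({ toFun := QuadConfig.dilate t ht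
     invFun := QuadConfig.dilate t⁻¹ (inv_ne_zero ht)
     left_inv := quadConfig_dilate_inv_dilate t ht
     right_inv := quadConfig_dilate_dilate_inv t ht
     continuous_toFun := continuous_quadConfig_dilate t ht
     continuous_invFun := continuous_quadConfig_dilate _ _ } :
      QuadConfig (univ : Set ℂ) ≃ₜ QuadConfig univ).measurableEmbedding

/-- `w ↦ t w` (`t ≠ 0` real) is a measurable embedding of `ℂ`. [folklore] -/
theorem measurableEmbedding_real_mul (t : ℝ) (ht : t ≠ 0) :
    MeasurableEmbedding (fun w : ℂ => (t : ℂ) * w) :=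
  (Homeomorph.mulLeft₀ (t : ℂ) (Complex.ofReal_ne_zero.mpr ht)).measurableEmbedding

/-- `w ↦ t w` is measurable. [folklore] -/
theorem measurable_real_mul (t : ℝ) : Measurable (fun w : ℂ => (t : ℂ) * w) :=
  (continuous_const.mul continuous_id).measurable

/-- A compactly supported test function stays compactly supported after the substitution `x = t y`.
[folklore] -/
theorem hasCompactSupport_comp_real_mul {φ : ℂ → ℝ} (hφ : HasCompactSupport φ) (t : ℝ) (ht : t ≠ 0) :
    HasCompactSupport (fun w : ℂ => φ ((t : ℂ) * w)) :=
  hφ.comp_homeomorph (Homeomorph.mulLeft₀ (t : ℂ) (Complex.ofReal_ne_zero.mpr ht))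

/-- **Pivotality in a dilated configuration**, read backwards: `t y` is pivotal for `Q` in `S_t S` iff
`y` is pivotal for `S_{t⁻¹} Q` in `S`. [folklore] -/
theorem isPivotalAt_dilate_mul_iff (t : ℝ) (ht : 0 < t) (S : QuadConfig (univ : Set ℂ)) (y : ℂ)
    (Q : Quad (univ : Set ℂ)) :
    (QuadConfig.dilate t ht.ne' S).IsPivotalAt ((t : ℂ) * y) Q ↔
      S.IsPivotalAt y (Q.dilate t⁻¹ (inv_ne_zero ht.ne')) := by
  conv_lhs => rw [← quad_dilate_dilate_inv t ht.ne' Q]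
  exact isPivotalAt_dilate_iff t ht S y _

/-! ### (F) transports -/

/-- **(F) transports under dilations** (registered sub-goal `isFlipFairKernel_map_dilate` of item
stmt-CriticalPhenomena-14826): if `M (ε/t)` is flip-fair for `P` then the rescaled kernel
`S ↦ (t·)_* M (ε/t) (S_{t⁻¹} S)` is flip-fair for `(S_t)_* P`. [folklore] -/
theorem isFlipFairKernel_map_dilate : ∀ (P : Measure (QuadConfig (Set.univ : Set ℂ))) (M : ℝ → QuadConfig (Set.univ : Set ℂ) → Measure ℂ) (t : ℝ) (ht : 0 < t) (ε : ℝ), IsFlipFairKernel P (M (ε / t)) → IsFlipFairKernel (Measure.map (QuadConfig.dilate t ht.ne') P) (fun S => Measure.map (fun w : ℂ => (t : ℂ) * w) (M (ε / t) (QuadConfig.dilate t⁻¹ (inv_ne_zero ht.ne') S))) := by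
  intro P M t ht ε hF n Q g φ hφ hφc
  have hD := measurableEmbedding_quadConfig_dilate t ht.ne'
  have hm := measurableEmbedding_real_mul t ht.ne'
  rw [hD.integral_map, hD.integral_map]
  simp_rw [quadConfig_dilate_inv_dilate, hm.integral_map, mem_quadConfig_dilate_iff t ht.ne',
    isPivotalAt_dilate_mul_iff t ht]
  exact hF n (fun i => (Q i).dilate t⁻¹ (inv_ne_zero ht.ne')) g (fun w => φ ((t : ℂ) * w))
    (hφ.comp (continuous_const.mul continuous_id)) (hasCompactSupport_comp_real_mul hφc t ht.ne')

end Summit.CriticalPhenomena.CardyFormulaZ2.Theorems.CardyMeckeFlip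

end
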